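import Summits.BirchSwinnertonDyer.BirchSwinnertonDyer.Theses.ShaPrimaryTransfer
import Literature.NumberTheory.EllipticCurves.KubertTateFiveMinimalModel
import Literature.NumberTheory.EllipticCurves.KubertTateFiveRational
import Literature.NumberTheory.EllipticCurves.ComplexMultiplicationLocalFactorsAux
import Literature.NumberTheory.EllipticCurves.OrdinaryPrimesProofs
import Literature.NumberTheory.EllipticCurves.PAdicLFunction
import Literature.NumberTheory.EllipticCurves.SelmerCorankHolds
import Literature.NumberTheory.EllipticCurves.IsogenyFrobeniusTraceProofs
import Literature.NumberTheory.EllipticCurves.IsogenyVariableChangeProofs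
import Literature.NumberTheory.EllipticCurves.NoEverywhereGoodReductionRat
import Literature.NumberTheory.EllipticCurves.PAdicGrossZagierConstantTermProofs
import Summits.BirchSwinnertonDyer.BirchSwinnertonDyer.Theorems.Rank1ResidualIntModelReduction
import HarnessLib

/-!
# The door prime `5` is X2-admissible CLASS-WIDE: `a₅(E) ∈ {1, −4}` for every elliptic curve over `ℚ` with a
# rational point of order `5` and good reduction at `5`

Helper for item **stmt-BirchSwinnertonDyer-22356** (`FiniteShaComponentTransfer`, «T», the transfer slice)
of route `ShaPrimaryTransfer`; closes nothing by itself; **BSD is NOT proved by this file** and `T` stays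
conjecture-grade at analytic rank `≥ 2`. It is the `X₁(5)`-twin of `…RowAtSevenClassWide`; the sequel
`…RowAtFiveTransferIdle` draws the consequence for the route's assembly (no transfer is needed on this class).

* §1–§2 (the family): for COPRIME `m, n` with `5 ∤ Δ`, the integral Kubert–Tate `5`-torsion curve
  `E_{m,n} = kubertTateFive m n = [n − m, −mn, −mn², 0, 0]` is a GLOBAL MINIMAL MODEL (tree
  `isGloballyMinimal_kubertTateFive_of_isCoprime`, file `KubertTateFiveMinimalModel`) with
  **`#Ẽ_{m,n}(𝔽₅) ∈ {5, 10}`, i.e. `a₅ ∈ {1, −4}`** — precisely `a₅ = −4` iff `m ≡ 2n (mod 5)` and `a₅ = 1` iff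
  `m ≡ ±n (mod 5)` (the `12` nonsingular residue pairs are decided in the kernel; conceptually the point `(0,0)`
  of order `5` survives reduction, so `5 ∣ #Ẽ(𝔽₅) ∈ [2, 10]`). Hence `5` is good ORDINARY for every tame
  coprime member (`goodOrdinary_five`): unlike the doors at `2` and `3`, the door prime `5` is itself a
  Kato–Skinner–Urban prime.
* §3 X2 at the door prime, class-wide: granting X2 = `AnalyticRankLeSelmerCorank`, `r_an(E_{m,n}) ≤ s₅(E_{m,n})`,
  and `≤ rank E_{m,n}(ℚ)` wherever the door is open (`t₅ = 0`, e.g. by the `μ₅`-descent of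
  `KubertTateFiveMuDescentBox`) — no transfer `T` is invoked.
* §4 EVERY elliptic curve over `ℚ` with a rational point of order `5` (universality + global minimality, file
  `KubertTateFiveRational`): with good reduction at `5` it has `a₅ ∈ {1, −4}`
  (`frobeniusTrace_five_of_addOrderOf_eq_five`), so `5` is good ordinary and X2-admissible
  (`isOrdinaryAt_five_of_addOrderOf_eq_five`, `analyticRank_le_selmerCorank_five_of_X2_of_addOrderOf_eq_five`),
  and `r_an(E) ≤ rank E(ℚ)` from X2 alone once `t₅(E) = 0`.

## References

* [SilvermanAEC2009] J. H. Silverman, *AEC*, 2nd ed., VII.1 Rem. 1.1, VII.3 Prop. 3.1(b), VII.5 Prop. 5.1, X.4.2.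
* [GreenbergLNM1716] R. Greenberg, *Iwasawa theory for elliptic curves*, LNM 1716, §1 (pp. 54–57).
* [Fisher2001FiveSevenDescent] T. Fisher, JEMS 3 (2001), §§1–2.
* [Kubert1976] D. S. Kubert, Proc. London Math. Soc. (3) 33 (1976), Table 3 (`N = 5`).
-/

noncomputable section

-- D-0017: single-problem summit, so `Summit.BirchSwinnertonDyer.BirchSwinnertonDyer.…` repeats a namespace BY DESIGN.
set_option linter.dupNamespace false
set_option autoImplicit false

open WeierstrassCurve
open Literature.NumberTheory.EllipticCurves
open Summit.BirchSwinnertonDyer.BirchSwinnertonDyer.Theses.ShaPrimaryTransfer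
open Summit.BirchSwinnertonDyer.BirchSwinnertonDyer.Rank1Residual

namespace Summit.BirchSwinnertonDyer.BirchSwinnertonDyer.Theorems.ShaPrimaryTransferRowAtFiveClassWide

/-! ## §1 Reduction modulo `5`: `#Ẽ_{m,n}(𝔽₅) ∈ {5, 10}` for every nonsingular residue pair -/

/-- The affine point count of `E_{a,b}` over `𝔽₅` is `4` for the `8` residue pairs with `Δ ≠ 0` and `a ≠ 2b`
(kernel decision over `𝔽₅ × 𝔽₅`). [folklore] -/
private theorem card_sol_zmod_five_of_ne : ∀ a b : ZMod 5, (kubertTateFive a b).Δ ≠ 0 → a ≠ 2 * b →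
    Fintype.card {xy : ZMod 5 × ZMod 5 // xy.2 ^ 2 + (kubertTateFive a b).a₁ * xy.1 * xy.2
      + (kubertTateFive a b).a₃ * xy.2 = xy.1 ^ 3 + (kubertTateFive a b).a₂ * xy.1 ^ 2
      + (kubertTateFive a b).a₄ * xy.1 + (kubertTateFive a b).a₆} = 4 := by
  decide +kernel

/-- The affine point count of `E_{a,b}` over `𝔽₅` is `9` for the `4` residue pairs with `b ≠ 0` and `a = 2b`
(kernel decision over `𝔽₅ × 𝔽₅`). [folklore] -/
private theorem card_sol_zmod_five_of_eq : ∀ a b : ZMod 5, b ≠ 0 → a = 2 * b →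
    Fintype.card {xy : ZMod 5 × ZMod 5 // xy.2 ^ 2 + (kubertTateFive a b).a₁ * xy.1 * xy.2
      + (kubertTateFive a b).a₃ * xy.2 = xy.1 ^ 3 + (kubertTateFive a b).a₂ * xy.1 ^ 2
      + (kubertTateFive a b).a₄ * xy.1 + (kubertTateFive a b).a₆} = 9 := by
  decide +kernel

/-- `Δ(E_{a,b}) ≠ 0` in `𝔽₅` forces `b ≠ 0` (`Δ = a⁵b⁵Q`). [folklore] -/
private theorem right_ne_zero_of_Δ_ne_zero : ∀ a b : ZMod 5, (kubertTateFive a b).Δ ≠ 0 → b ≠ 0 := by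
  decide +kernel

/-- **`#E_{a,b}(𝔽₅) = 5` for every nonsingular Kubert–Tate `5`-torsion curve over `𝔽₅` with `a ≠ 2b`** (`a₅ = 1`:
anomalous). [cite: SilvermanAEC2009, VII.3 Prop. 3.1(b)] -/
theorem natCard_point_kubertTateFive_zmod_five_of_ne (a b : ZMod 5) (h : (kubertTateFive a b).Δ ≠ 0)
    (hab : a ≠ 2 * b) : Nat.card (kubertTateFive a b).toAffine.Point = 5 := by
  have h1 := natCard_point_eq_one_add_card (F := ZMod 5) (kubertTateFive a b) h
  have h2 := card_sol_zmod_five_of_ne a b h hab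
  simp only [h2] at h1
  exact h1

/-- **`#E_{a,b}(𝔽₅) = 10` for every nonsingular Kubert–Tate `5`-torsion curve over `𝔽₅` with `a = 2b`** (`a₅ = −4`).
[cite: SilvermanAEC2009, VII.3 Prop. 3.1(b)] -/
theorem natCard_point_kubertTateFive_zmod_five_of_eq (a b : ZMod 5) (h : (kubertTateFive a b).Δ ≠ 0)
    (hab : a = 2 * b) : Nat.card (kubertTateFive a b).toAffine.Point = 10 := by
  have h1 := natCard_point_eq_one_add_card (F := ZMod 5) (kubertTateFive a b) h
  have h2 := card_sol_zmod_five_of_eq a b (right_ne_zero_of_Δ_ne_zero a b h) hab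
  simp only [h2] at h1
  exact h1

/-- **`#E_{a,b}(𝔽₅) ∈ {5, 10}` for every nonsingular Kubert–Tate `5`-torsion curve over `𝔽₅`** (the rational point
`(0,0)` of order `5` forces `5 ∣ #E(𝔽₅) ∈ [2, 10]`). [cite: SilvermanAEC2009, VII.3 Prop. 3.1(b)] -/
theorem natCard_point_kubertTateFive_zmod_five (a b : ZMod 5) (h : (kubertTateFive a b).Δ ≠ 0) :
    Nat.card (kubertTateFive a b).toAffine.Point = 5 ∨ Nat.card (kubertTateFive a b).toAffine.Point = 10 := by
  by_cases hab : a = 2 * b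
  · exact Or.inr (natCard_point_kubertTateFive_zmod_five_of_eq a b h hab)
  · exact Or.inl (natCard_point_kubertTateFive_zmod_five_of_ne a b h hab)

/-- The integer equation of `E_{m,n}` reduces modulo `5` to `E_{m̄,n̄}` over `𝔽₅`. [folklore] -/
theorem map_mk_zmod_five (m n : ℤ) :
    (⟨n - m, -(m * n), -(m * n ^ 2), 0, 0⟩ : WeierstrassCurve ℤ).map (Int.castRingHom (ZMod 5)) =
      kubertTateFive (m : ZMod 5) (n : ZMod 5) := by
  rw [mk_eq_kubertTateFive_int, map_kubertTateFive]
  simp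

/-- `Δ(E_{m̄,n̄}) ≠ 0` in `𝔽₅` when `5 ∤ Δ(E_{m,n})`. [folklore] -/
theorem Δ_zmod_five_ne_zero (m n : ℤ) (h5 : ¬ (5 : ℤ) ∣ (kubertTateFive m n).Δ) :
    (kubertTateFive (m : ZMod 5) (n : ZMod 5)).Δ ≠ 0 := by
  rw [← map_mk_zmod_five, map_Δ, mk_eq_kubertTateFive_int, eq_intCast, Ne,
    ZMod.intCast_zmod_eq_zero_iff_dvd]
  exact_mod_cast h5

/-- `m̄ = 2n̄` in `𝔽₅` iff `5 ∣ m − 2n`. [folklore] -/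
theorem cast_eq_two_mul_cast_iff (m n : ℤ) : (m : ZMod 5) = 2 * (n : ZMod 5) ↔ (5 : ℤ) ∣ m - 2 * n := by
  have e : (2 : ZMod 5) * (n : ZMod 5) = ((2 * n : ℤ) : ZMod 5) := by push_cast; ring
  rw [e, ZMod.intCast_eq_intCast_iff_dvd_sub, dvd_sub_comm]
  norm_num

/-- **`#Ẽ_{m,n}(𝔽₅) ∈ {5, 10}` for all integers `m, n` with `5 ∤ Δ(E_{m,n})`.** [cite: SilvermanAEC2009, VII.3 Prop. 3.1(b)] -/
theorem natCard_point_five (m n : ℤ) (h5 : ¬ (5 : ℤ) ∣ (kubertTateFive m n).Δ) :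
    Nat.card (((⟨n - m, -(m * n), -(m * n ^ 2), 0, 0⟩ : WeierstrassCurve ℤ).map
        (Int.castRingHom (ZMod 5))).toAffine.Point) = 5 ∨
      Nat.card (((⟨n - m, -(m * n), -(m * n ^ 2), 0, 0⟩ : WeierstrassCurve ℤ).map
        (Int.castRingHom (ZMod 5))).toAffine.Point) = 10 := by
  rw [map_mk_zmod_five]
  exact natCard_point_kubertTateFive_zmod_five _ _ (Δ_zmod_five_ne_zero m n h5)

/-- `#Ẽ_{m,n}(𝔽₅) = 5` when `5 ∤ Δ(E_{m,n})` and `m ≢ 2n (mod 5)`. [cite: SilvermanAEC2009, VII.3 Prop. 3.1(b)] -/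
theorem natCard_point_five_of_not_dvd (m n : ℤ) (h5 : ¬ (5 : ℤ) ∣ (kubertTateFive m n).Δ)
    (hmn : ¬ (5 : ℤ) ∣ m - 2 * n) :
    Nat.card (((⟨n - m, -(m * n), -(m * n ^ 2), 0, 0⟩ : WeierstrassCurve ℤ).map
        (Int.castRingHom (ZMod 5))).toAffine.Point) = 5 := by
  rw [map_mk_zmod_five]
  exact natCard_point_kubertTateFive_zmod_five_of_ne _ _ (Δ_zmod_five_ne_zero m n h5)
    (fun h ↦ hmn ((cast_eq_two_mul_cast_iff m n).mp h))

/-- `#Ẽ_{m,n}(𝔽₅) = 10` when `5 ∤ Δ(E_{m,n})` and `m ≡ 2n (mod 5)`. [cite: SilvermanAEC2009, VII.3 Prop. 3.1(b)] -/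
theorem natCard_point_five_of_dvd (m n : ℤ) (h5 : ¬ (5 : ℤ) ∣ (kubertTateFive m n).Δ)
    (hmn : (5 : ℤ) ∣ m - 2 * n) :
    Nat.card (((⟨n - m, -(m * n), -(m * n ^ 2), 0, 0⟩ : WeierstrassCurve ℤ).map
        (Int.castRingHom (ZMod 5))).toAffine.Point) = 10 := by
  rw [map_mk_zmod_five]
  exact natCard_point_kubertTateFive_zmod_five_of_eq _ _ (Δ_zmod_five_ne_zero m n h5)
    ((cast_eq_two_mul_cast_iff m n).mpr hmn)

/-! ## §2 The integral model, `a₅ ∈ {1, −4}`, good ordinary reduction at `5` — class-wide -/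

/-- For a globally minimal `E_{m,n}/ℚ` the tree's integral model is the Kubert–Tate integer equation.
[cite: SilvermanAEC2009, VIII.8] -/
theorem integralModelInt_kubertTateFive (m n : ℤ) [(kubertTateFive (m : ℚ) (n : ℚ)).IsGloballyMinimal] :
    integralModelInt (kubertTateFive (m : ℚ) (n : ℚ)) = ⟨n - m, -(m * n), -(m * n ^ 2), 0, 0⟩ :=
  IntModel.integralModelInt_eq_of_map_eq _ (kubertTateFive_rat_eq_map_mk m n).symm

/-- **`a₅(E_{m,n}) ∈ {1, −4}` class-wide** (`m, n` coprime, `5 ∤ Δ`). [cite: SilvermanAEC2009, VII.3 Prop. 3.1(b) and V.2] -/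
theorem frobeniusTrace_five (m n : ℤ) (hcop : IsCoprime m n) (h5 : ¬ (5 : ℤ) ∣ (kubertTateFive m n).Δ) :
    haveI := isGloballyMinimal_kubertTateFive_of_isCoprime m n hcop
    (kubertTateFive (m : ℚ) (n : ℚ)).frobeniusTrace 5 = 1 ∨
      (kubertTateFive (m : ℚ) (n : ℚ)).frobeniusTrace 5 = -4 := by
  haveI := isGloballyMinimal_kubertTateFive_of_isCoprime m n hcop
  rcases natCard_point_five m n h5 with h | h
  · left
    rw [IntModel.frobeniusTrace_eq (integralModelInt_kubertTateFive m n) h]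
    norm_num
  · right
    rw [IntModel.frobeniusTrace_eq (integralModelInt_kubertTateFive m n) h]
    norm_num

/-- **`a₅(E_{m,n}) = 1` (anomalous) when `m ≢ 2n (mod 5)`** (`m, n` coprime, `5 ∤ Δ`, i.e. `m ≡ ±n (mod 5)`).
[cite: SilvermanAEC2009, VII.3 Prop. 3.1(b) and V.2] -/
theorem frobeniusTrace_five_eq_one (m n : ℤ) (hcop : IsCoprime m n) (h5 : ¬ (5 : ℤ) ∣ (kubertTateFive m n).Δ)
    (hmn : ¬ (5 : ℤ) ∣ m - 2 * n) :
    haveI := isGloballyMinimal_kubertTateFive_of_isCoprime m n hcop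
    (kubertTateFive (m : ℚ) (n : ℚ)).frobeniusTrace 5 = 1 := by
  haveI := isGloballyMinimal_kubertTateFive_of_isCoprime m n hcop
  rw [IntModel.frobeniusTrace_eq (integralModelInt_kubertTateFive m n) (natCard_point_five_of_not_dvd m n h5 hmn)]
  norm_num

/-- **`a₅(E_{m,n}) = −4` when `m ≡ 2n (mod 5)`** (`m, n` coprime, `5 ∤ Δ`). [cite: SilvermanAEC2009, VII.3 Prop. 3.1(b) and V.2] -/
theorem frobeniusTrace_five_eq_neg_four (m n : ℤ) (hcop : IsCoprime m n)
    (h5 : ¬ (5 : ℤ) ∣ (kubertTateFive m n).Δ) (hmn : (5 : ℤ) ∣ m - 2 * n) :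
    haveI := isGloballyMinimal_kubertTateFive_of_isCoprime m n hcop
    (kubertTateFive (m : ℚ) (n : ℚ)).frobeniusTrace 5 = -4 := by
  haveI := isGloballyMinimal_kubertTateFive_of_isCoprime m n hcop
  rw [IntModel.frobeniusTrace_eq (integralModelInt_kubertTateFive m n) (natCard_point_five_of_dvd m n h5 hmn)]
  norm_num

/-- **`5` is a prime of good ORDINARY reduction of `E_{m,n}` class-wide** (`m, n` coprime, `5 ∤ Δ`):
`5 ∤ Δ_min = Δ(E_{m,n})` and `5 ∤ a₅ ∈ {1, −4}`. [cite: SilvermanAEC2009, VII.5 Prop. 5.1(a)] -/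
theorem goodOrdinary_five (m n : ℤ) (hcop : IsCoprime m n) (h5 : ¬ (5 : ℤ) ∣ (kubertTateFive m n).Δ) :
    haveI := isGloballyMinimal_kubertTateFive_of_isCoprime m n hcop
    (kubertTateFive (m : ℚ) (n : ℚ)).HasGoodReductionAtPrime 5 ∧
      ¬ ((5 : ℕ) : ℤ) ∣ (kubertTateFive (m : ℚ) (n : ℚ)).frobeniusTrace 5 := by
  haveI := isGloballyMinimal_kubertTateFive_of_isCoprime m n hcop
  refine ⟨hasGoodReductionAtPrime_of_not_dvd _ 5 ?_, ?_⟩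
  · rw [IntModel.minimalDiscriminantInt_eq (integralModelInt_kubertTateFive m n), mk_eq_kubertTateFive_int]
    exact_mod_cast h5
  · rcases frobeniusTrace_five m n hcop h5 with h | h <;> rw [h] <;> decide

/-- `5` is good ordinary for `E_{m,n}` in the `IsOrdinaryAt` packaging of the `p`-adic `L`-function files.
[cite: SilvermanAEC2009, VII.5 Prop. 5.1(a)] -/
theorem isOrdinaryAt_five (m n : ℤ) (hcop : IsCoprime m n) (h5 : ¬ (5 : ℤ) ∣ (kubertTateFive m n).Δ) :
    haveI := isGloballyMinimal_kubertTateFive_of_isCoprime m n hcop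
    IsOrdinaryAt (kubertTateFive (m : ℚ) (n : ℚ)) 5 :=
  goodOrdinary_five m n hcop h5

/-! ## §3 X2 at the door prime, class-wide -/

/-- **X2 applies at `p = 5` to EVERY tame coprime `E_{m,n}`**: granting `AnalyticRankLeSelmerCorank` (X2),
`ord_{s=1} L(E_{m,n}, s) ≤ s₅(E_{m,n})`. CONDITIONAL on `hX2` only. [cite: GreenbergLNM1716, §1 (pp. 54–57)] -/
theorem analyticRank_le_selmerCorank_five_of_X2 (hX2 : AnalyticRankLeSelmerCorank) (m n : ℤ)
    [(kubertTateFive (m : ℚ) (n : ℚ)).IsElliptic] (hcop : IsCoprime m n)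
    (h5 : ¬ (5 : ℤ) ∣ (kubertTateFive m n).Δ) :
    (kubertTateFive (m : ℚ) (n : ℚ)).analyticRank ≤ (kubertTateFive (m : ℚ) (n : ℚ)).selmerCorank 5 := by
  haveI := isGloballyMinimal_kubertTateFive_of_isCoprime m n hcop
  have hgo := goodOrdinary_five m n hcop h5
  exact hX2 (kubertTateFive (m : ℚ) (n : ℚ)) 5 le_rfl hgo.1 hgo.2

/-- **X2 + an open door at `5` give `ord_{s=1} L(E_{m,n}, s) ≤ rank E_{m,n}(ℚ)`** for every tame coprime `E_{m,n}`
with `t₅(E_{m,n}) = 0` (`s₅ = rank + t₅`). CONDITIONAL on `hX2` only — no transfer `T`.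
[cite: GreenbergLNM1716, §1 (pp. 54–57)] [cite: SilvermanAEC2009, Thm. X.4.2(b)] -/
theorem analyticRank_le_mordellWeilRank_of_X2 (hX2 : AnalyticRankLeSelmerCorank) (m n : ℤ)
    [(kubertTateFive (m : ℚ) (n : ℚ)).IsElliptic] (hcop : IsCoprime m n)
    (h5 : ¬ (5 : ℤ) ∣ (kubertTateFive m n).Δ) (ht : (kubertTateFive (m : ℚ) (n : ℚ)).shaCorank 5 = 0) :
    (kubertTateFive (m : ℚ) (n : ℚ)).analyticRank ≤ (kubertTateFive (m : ℚ) (n : ℚ)).mordellWeilRank := by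
  have h := analyticRank_le_selmerCorank_five_of_X2 hX2 m n hcop h5
  rw [(kubertTateFive (m : ℚ) (n : ℚ)).selmerCorank_eq_mordellWeilRank_add_holds 5, ht, add_zero] at h
  exact h

/-! ## §4 EVERY elliptic curve over `ℚ` with a rational point of order `5` -/

/-- Good reduction at `5` of the coprime Kubert–Tate model means `5 ∤ Δ(E_{m,n})` (the model is globally minimal,
so `Δ_min = Δ(E_{m,n})`). [cite: SilvermanAEC2009, VII.5 Prop. 5.1(a)] -/
theorem not_five_dvd_Δ_of_hasGoodReductionAtPrime (m n : ℤ) (hcop : IsCoprime m n)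
    (hgood : (kubertTateFive (m : ℚ) (n : ℚ)).HasGoodReductionAtPrime 5) :
    ¬ (5 : ℤ) ∣ (kubertTateFive m n).Δ := by
  haveI := isGloballyMinimal_kubertTateFive_of_isCoprime m n hcop
  have h := not_dvd_minimalDiscriminantInt_of_hasGoodReductionAtPrime (W := kubertTateFive (m : ℚ) (n : ℚ))
    5 hgood
  rw [IntModel.minimalDiscriminantInt_eq (integralModelInt_kubertTateFive m n), mk_eq_kubertTateFive_int] at h
  exact_mod_cast h

/-- **Every elliptic curve over `ℚ` with a rational point of order `5` and good reduction at `5` has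
`a₅(E) ∈ {1, −4}`** (global minimal model `E`; `a_p` is an isomorphism invariant at good primes, tree
`frobeniusTrace_eq_of_isIsogenous`; the Kubert–Tate model has `#Ẽ(𝔽₅) ∈ {5, 10}`).
[cite: SilvermanAEC2009, VII.3 Prop. 3.1(b) and VII.5 Prop. 5.1(a)] -/
theorem frobeniusTrace_five_of_addOrderOf_eq_five (W : WeierstrassCurve ℚ) [W.IsElliptic]
    [W.IsGloballyMinimal] (P : W.toAffine.Point) (hP : addOrderOf P = 5)
    (hgood : W.HasGoodReductionAtPrime 5) : W.frobeniusTrace 5 = 1 ∨ W.frobeniusTrace 5 = -4 := by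
  obtain ⟨m, n, C, hC, hcop, -, -⟩ := exists_variableChange_eq_kubertTateFive_of_addOrderOf_eq_five W P hP
  haveI hE : (kubertTateFive (m : ℚ) (n : ℚ)).IsElliptic := by rw [← hC]; infer_instance
  have hgood' : (kubertTateFive (m : ℚ) (n : ℚ)).HasGoodReductionAtPrime 5 := by
    rw [← hC]; exact (hasGoodReductionAtPrime_iff_of_variableChange W C 5).mpr hgood
  have h5 : ¬ (5 : ℤ) ∣ (kubertTateFive m n).Δ := not_five_dvd_Δ_of_hasGoodReductionAtPrime m n hcop hgood'
  haveI := isGloballyMinimal_kubertTateFive_of_isCoprime m n hcop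
  rw [frobeniusTrace_eq_of_isIsogenous (isIsogenous_of_smul_eq hC) 5 hgood hgood']
  exact frobeniusTrace_five m n hcop h5

/-- **`5` is good ORDINARY for every elliptic curve over `ℚ` with a rational point of order `5` and good
reduction at `5`** (`5 ∤ a₅ ∈ {1, −4}`). [cite: SilvermanAEC2009, VII.5 Prop. 5.1(a)] -/
theorem isOrdinaryAt_five_of_addOrderOf_eq_five (W : WeierstrassCurve ℚ) [W.IsElliptic]
    [W.IsGloballyMinimal] (P : W.toAffine.Point) (hP : addOrderOf P = 5)
    (hgood : W.HasGoodReductionAtPrime 5) : IsOrdinaryAt W 5 := by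
  refine ⟨hgood, ?_⟩
  rcases frobeniusTrace_five_of_addOrderOf_eq_five W P hP hgood with h | h <;> rw [h] <;> decide

/-- **X2 applies at `p = 5` to EVERY elliptic curve over `ℚ` with a rational point of order `5` and good reduction
at `5`**: granting `AnalyticRankLeSelmerCorank`, `ord_{s=1} L(E, s) ≤ s₅(E)` (global minimal model `E`).
CONDITIONAL on `hX2` only. [cite: GreenbergLNM1716, §1 (pp. 54–57)] -/
theorem analyticRank_le_selmerCorank_five_of_X2_of_addOrderOf_eq_five (hX2 : AnalyticRankLeSelmerCorank)
    (W : WeierstrassCurve ℚ) [W.IsElliptic] [W.IsGloballyMinimal] (P : W.toAffine.Point)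
    (hP : addOrderOf P = 5) (hgood : W.HasGoodReductionAtPrime 5) :
    W.analyticRank ≤ W.selmerCorank 5 :=
  hX2 W 5 le_rfl hgood (isOrdinaryAt_five_of_addOrderOf_eq_five W P hP hgood).2

/-- **`r_an(W) ≤ rank W(ℚ)` from X2 alone for every globally minimal elliptic `W/ℚ` with a rational point of order
`5`, good reduction at `5` and an open door at `5` (`t₅(W) = 0`)** — leg 1 of the route's assembly at the door prime
itself; no transfer `T`. CONDITIONAL on `hX2`. [cite: GreenbergLNM1716, §1 (pp. 54–57)] -/
theorem analyticRank_le_mordellWeilRank_of_X2_of_addOrderOf_eq_five (hX2 : AnalyticRankLeSelmerCorank)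
    (W : WeierstrassCurve ℚ) [W.IsElliptic] [W.IsGloballyMinimal] (P : W.toAffine.Point)
    (hP : addOrderOf P = 5) (hgood : W.HasGoodReductionAtPrime 5) (ht : W.shaCorank 5 = 0) :
    W.analyticRank ≤ W.mordellWeilRank := by
  have h := analyticRank_le_selmerCorank_five_of_X2_of_addOrderOf_eq_five hX2 W P hP hgood
  rw [W.selmerCorank_eq_mordellWeilRank_add_holds 5, ht, add_zero] at h
  exact h

end Summit.BirchSwinnertonDyer.BirchSwinnertonDyer.Theorems.ShaPrimaryTransferRowAtFiveClassWide

end
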